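import Summits.QuantumFields.BalabanUV.Beta.EriceRemainderEnclosureHistoryAutonomyComparisonAgeCompositionDecayHorizon

/-!
# EriceRemainderEnclosureHistoryAutonomyComparisonAgeCompositionLightLoad — (E86i) route (N), first order: THE LIGHT-LOAD END — for ANY profile, ANY damping
# in `]0,1]`, ANY horizon: if the AGGREGATE damped row mass `Σ_k Σ_l KL k m l` is at most `1` at every pin, the comparison surplus of every admissible excess is
# non-negative ((E71a) `sol_nonneg_le_of_antitone` along the flow) — the corner of the census where every monotonicity statement fails is of this kind

Cell `pub-balaban`, β-function sub-cell, BINDER row D4 «RemainderConst leaves for Bałaban's split» (`HOME/BINDER-OWNERS.md`; owner lineage `b2b-balaban-beta-an4`;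
this file by co-owner #2 lineage `b2b-balaban-beta-d4-p2`, generation 77), β-FLOW TEAM duty (1), FREEZE (0) honoured (def-free; imports (E86a) `…DecayHorizon`;
uses (E71a) `sol_nonneg_le_of_antitone`, (E80a) `weight_nonneg`, (E80b) `aggregate_eq_sum`, (E86a) `sum_range_of_le`∕`aggregate_eq_zero_of_horizon` BY NAME;
nothing restated).

HONEST FRAMING (page 1, verbatim and binding).  *"Discharging BetaPertH makes Bałaban's UV stability UNCONDITIONAL — a real constructive-QFT result; it is
NOT the continuum limit and NOT the Clay problem."*  THIS FILE DISCHARGES NOTHING OF THE KIND.  Elementary real analysis about ABSTRACT functionals on a box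
]0,γ]^ℕ with displayed floors, profiles and signs, and the FIRST-ORDER renewal objects of route (N) built from them — hypotheses of a census, not facts; the
form, signs, ages and moments of Bałaban's (1.22) limit functional are NOT PRINTED ([I] p. 298; GAPS G-t4-U2-1∕-2) and NOT asserted.  Row D4 class
UNCHANGED (critical-path width 0; instance 0∕1; D4 DISCHARGE NO DATE).  HONEST DEPENDENCY: continuum YM on T⁴ ⇐ BetaPertH ∧ nine spine estimates (0/9
proved); BetaPertH ⇐ (D1) ∧ (D4) ∧ CAP+tail; G-an2-4 gates asym, D1 and NE2/3/4.

THE POINT (census sense (α); route (N); README `HOME/b2b-balaban-beta-d4-p2/g77/e86/README.md` §3 (B), §4).  The generation-77 adversarial census located the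
one corner where EVERY sign-exact monotonicity statement about an age `k` fails — its static surrogates (S-a), (S-c♯), (S-f), (S-e″) AND the exact MONO″∕(M1):
a light age under a loaded younger one with levels flat at the window's end (the row slides off the damped scales while its coefficient does not decay).  In
that corner the total damped mass is the young age's alone (`≤ 0.71`), and positivity needs no induction at all: **`flow_nonneg_of_light_total_mass`** — for ANY
profile `L ≥ 0` on the ages `< K`, `h` a box solution (only `h > 0` is used), ANY damping `0 < g ≤ 1`, ANY horizon `N ≥ K`: IF the aggregate damped row mass
satisfies `Σ_{l<K} KA 1 m l ≤ 1` at every pin `m`, THEN `0 ≤ ε ≤ e` for every admissible excess ((E71a) `sol_nonneg_le_of_antitone`: a non-increasing input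
read by a kernel of row mass `≤ 1` dominates its own read).  This is the first-order «Λ ≤ 1» criterion of README g60/e70 §PS in the tree's letters; it is NOT
a substitute for the induction (three loaded ages reach total mass `≈ 1.2`), only the certificate for the light corner.  NOT CLAIMED: anything beyond the
displayed hypothesis; anything printed — NOT B12 Thm 2, NOT BetaPertH.

WHAT IS PROVED ([folklore]; 0 `def`, 0 sorry).  **`flow_nonneg_of_light_total_mass`**.
-/
noncomputable section
open Finset

namespace Summit.QuantumFields.BalabanUV.Beta.EriceRemainderEnclosureHistoryAutonomyComparisonAgeCompositionLightLoad

open Literature.MathematicalPhysics.QuantumFieldTheory.Balaban1983to89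
open Literature.MathematicalPhysics.QuantumFieldTheory.Balaban1983to89.T4BetaStationary
open Summit.QuantumFields.BalabanUV.Beta.EriceRemainderEnclosureHistoryAutonomyComparisonAgeComposition (sol_nonneg_le_of_antitone)
open Summit.QuantumFields.BalabanUV.Beta.EriceRemainderEnclosureHistoryAutonomyComparisonAgeCompositionIdentification (weight_nonneg)
open Summit.QuantumFields.BalabanUV.Beta.EriceRemainderEnclosureHistoryAutonomyComparisonAgeCompositionChainWiring (aggregate_eq_sum)
open Summit.QuantumFields.BalabanUV.Beta.EriceRemainderEnclosureHistoryAutonomyComparisonAgeCompositionDecayHorizon (sum_range_of_le aggregate_eq_zero_of_horizon)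

variable {γ : ℝ} {L : ℕ → ℝ} {K : ℕ} {h g : ℕ → ℝ} {KL : ℕ → ℕ → ℕ → ℝ}

/-- **ROUTE (N), FIRST ORDER — THE LIGHT-LOAD END (ANY PROFILE, ANY DAMPING, ANY HORIZON).**  `L ≥ 0` on the ages `< K` (`K ≥ 1`), `h` a box history, `g` a
damping with `0 < g ≤ 1`, the lone kernels `KL` and their aggregates `KA` as displayed, horizon `N ≥ K`.  IF `Σ_{l<K} KA 1 m l ≤ 1` at every pin `m` (the
aggregate damped row mass), THEN the comparison surplus `ε` of every admissible excess `e` (`e ≥ 0` non-increasing, `e_m = 0` for `m > N`) satisfies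
`0 ≤ ε m ≤ e m` at every pin. [folklore] -/
theorem flow_nonneg_of_light_total_mass (hL : ∀ k, 0 ≤ L k) (hh : SeqBox γ h) (hg : ∀ t, 0 < g t ∧ g t ≤ 1) (hK : 1 ≤ K) {N : ℕ} (hKN : K ≤ N)
    (hKL : ∀ k n l, KL k n l = if 0 < k ∧ k < K ∧ l < k then L k * h (n + k) ^ 3 / 2 * ∏ t ∈ Ico (n + 1 + l) (n + k + 1), g t else 0)
    {KA : ℕ → ℕ → ℕ → ℝ} {RA : ℕ → (ℕ → ℝ) → ℕ → ℝ}
    (hRA : ∀ i v m, RA i v m = ∑ l ∈ range K, KA i m l * v (m + 1 + l))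
    (hKA : ∀ i m l, KA i m l = KL i m l + KA (i + 1) m l) (hKAtop : ∀ m l, KA K m l = 0)
    (hlight : ∀ m, ∑ l ∈ range K, KA 1 m l ≤ 1)
    {e ε : ℕ → ℝ} (he0 : ∀ m, 0 ≤ e m) (hea : ∀ m, e (m + 1) ≤ e m)
    (hεt : ∀ m, N < m → ε m = 0) (hεrec : ∀ m, ε m = e m - RA 1 ε m) : ∀ m, 0 ≤ ε m ∧ ε m ≤ e m := by
  have hh0 : ∀ n, 0 < h n := fun n => (hh n).1
  have hKL0 := weight_nonneg hL hh0 hg hKL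
  have hKLK : ∀ i m l, K ≤ l + 1 → KL i m l = 0 := fun i m l hl => by rw [hKL, if_neg (by omega)]
  have hKLtop : ∀ i m l, K ≤ i → KL i m l = 0 := fun i m l hi => by rw [hKL, if_neg (by omega)]
  have hKA0 : ∀ i m l, K ≤ l → KA i m l = 0 :=
    aggregate_eq_zero_of_horizon hKA hKAtop (fun i m l hl => hKLK i m l (by omega)) hKLtop
  -- the aggregate of the whole profile: non-negative, and its reads on `range N`
  have hKA1 : ∀ m l, KA 1 m l = ∑ k ∈ Ico 1 (K - 1 + 1), KL k m l := fun m l =>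
    aggregate_eq_sum (n := K - 1) hKA (fun m l => by rw [Nat.sub_add_cancel hK]; exact hKAtop m l) (show 1 ≤ K - 1 + 1 by omega) m l
  have hKA10 : ∀ m l, 0 ≤ KA 1 m l := fun m l => by rw [hKA1]; exact sum_nonneg fun k _ => hKL0 k m l
  have hRA' : ∀ v m, RA 1 v m = ∑ l ∈ range N, KA 1 m l * v (m + 1 + l) := fun v m => by
    rw [hRA]; exact sum_range_of_le hKN fun l hl => by rw [hKA0 1 m l hl, zero_mul]
  have hrow : ∀ m, ∑ l ∈ range N, KA 1 m l ≤ 1 := fun m => by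
    rw [← sum_range_of_le hKN fun l hl => hKA0 1 m l hl]; exact hlight m
  exact sol_nonneg_le_of_antitone (K := KA 1) (R := RA 1) hRA' hKA10 hrow he0 hea hεt hεrec

end Summit.QuantumFields.BalabanUV.Beta.EriceRemainderEnclosureHistoryAutonomyComparisonAgeCompositionLightLoad

end
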